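import Literature.Geometry.Kaehler.FiniteGroupHolomorphicLinearization
import HarnessLib

/-!
# A holomorphic family read in Cartan's linearising chart at a fixed point: `h = ψ ∘ π ∘ σ⁻¹` is
# holomorphic near `0`, `Dh(0) = dπ_a` and `Dh(0) ∘ L(g) = Dh(0)` (PROVED; the computation behind
# `FixedLocusLocalSection`, recorded on its own for the finite-fibre variant)

Layer `Literature/Geometry/Kaehler`; technical companion of `FiniteGroupHolomorphicLinearization.lean`
(H. Cartan 1957 §4: `exists_linearizing_chart_chartAt` — a chart `σ` at a fixed point `a` of a finite
group `G` of biholomorphic maps in which `G` acts LINEARLY, `σ ∘ ρ g = L g ∘ σ`, with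
`L g = dρ(g)_a` and `σ` tangent to `chartAt E a`) and of `FixedLocusLocalSection.lean`, whose proof of
`exists_local_section_of_fixedPoints` performs, inline, the computation isolated here so that the
files `FixedLocusIsolatedTransversal.lean` / `FixedLocusFiniteFibre.lean` (cross-ladder literature
layer of ladder HodgeAV, rung H3, cell `hodge-kum4`, sub-home `lit-family`, tranche LT-H3 (b)+(c):
«the fixed locus of a finite group acting fibrewise on a smooth proper family is smooth over the
base … finite étale of locally constant degree», analytic category) can reuse it.

## Statement (tree carriers) and proof

`M`, `B` complex manifolds modelled on `E`, `EB` (`IsManifold 𝓘(ℂ, E) ω M`, `IsManifold 𝓘(ℂ, EB) ω B`),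
`π : M → B` holomorphic, `ρ : G →* (M ≃ₜ M)` with `π ∘ ρ g = π`, and a chart `σ` of the holomorphic
atlas at `a` (`σ a = 0`) with `G`-stable source on which `σ (ρ g x) = L g (σ x)`, tangent to
`chartAt E a` at `a` (the output of `exists_linearizing_chart_chartAt`).  CONCLUSION
(`exists_chart_proj_hasFDerivAt`): there is an open `V ∋ 0`, `V ⊆ σ.target`, mapped by `σ⁻¹` into
`σ.source ∩ π⁻¹(ψ.source)` (`ψ = chartAt EB (π a)`), on which `h = ψ ∘ π ∘ σ⁻¹` is holomorphic, and
`T = Dh(0)` (`fderiv`) satisfies `T ∘ L g = T` for every `g` (from `π ∘ ρ g = π`) and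
`T v = dπ_a v` (`mfderiv`, read in the preferred charts — `h = (ψ ∘ π ∘ φ⁻¹) ∘ (φ ∘ σ⁻¹)`,
`φ = chartAt E a`, the second factor tangent to the identity).  This is the first half of Cartan's
remark that in linearising coordinates everything about the fixed locus `σ⁻¹(E^{L(G)})` is read off
LINEAR data [Cartan 1957 §4, proof of Théorème 4; B. Edixhoven, Compositio Math. 81 (1992) Prop. 3.4,
proof: the map `X^G → S` in formal linearising coordinates].  Everything proved; no definitions, no
instances, no notation, no named fact.
-/

noncomputable section

open scoped Manifold ContDiff Topology
open Function Set Filter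

universe u v u' v' w

namespace Literature.Geometry.Kaehler

section ChartData

variable {E : Type u} [NormedAddCommGroup E] [NormedSpace ℂ E]
  {M : Type v} [TopologicalSpace M] [ChartedSpace E M] [IsManifold 𝓘(ℂ, E) ω M]
  {EB : Type u'} [NormedAddCommGroup EB] [NormedSpace ℂ EB]
  {B : Type v'} [TopologicalSpace B] [ChartedSpace EB B] [IsManifold 𝓘(ℂ, EB) ω B]
  {G : Type w} [Group G]

/-- **The family read in a linearising chart** (the computation inside
`exists_local_section_of_fixedPoints`, recorded on its own): for a chart `σ` at `a` from the
holomorphic atlas with `σ a = 0`, `G`-stable source on which `ρ` is linear (`σ ∘ ρ g = L g ∘ σ`) and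
tangent to `chartAt E a` at `a`, the map `h = ψ ∘ π ∘ σ⁻¹` (`ψ = chartAt EB (π a)`) is holomorphic
on an open `V ∋ 0`, `V ⊆ σ.target`, lying over the chart domains, and its derivative `T = Dh(0)`
satisfies `T ∘ L g = T` and `T = dπ_a` (Mathlib's `mfderiv`, read in the preferred charts).
[cite: Cartan1957QuotientAnalytique, §4 (proof of Théorème 4)] -/
theorem exists_chart_proj_hasFDerivAt (ρ : G →* (M ≃ₜ M))
    {π : M → B} (hπ : ContMDiff 𝓘(ℂ, E) 𝓘(ℂ, EB) ω π) (hπρ : ∀ (g : G) (x : M), π (ρ g x) = π x)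
    {a : M} {σ : OpenPartialHomeomorph M E} (hσmax : σ ∈ IsManifold.maximalAtlas 𝓘(ℂ, E) ω M)
    (haσ : a ∈ σ.source) (hσa : σ a = 0)
    (hσstab : ∀ g : G, ∀ x ∈ σ.source, ρ g x ∈ σ.source) {L : G →* (E →L[ℂ] E)}
    (hσlin : ∀ g : G, ∀ x ∈ σ.source, σ (ρ g x) = L g (σ x))
    (hσtan : HasFDerivAt (σ ∘ (chartAt E a).symm) (ContinuousLinearMap.id ℂ E) (chartAt E a a)) :
    ∃ V : Set E, IsOpen V ∧ (0 : E) ∈ V ∧ V ⊆ σ.target ∧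
      (∀ v ∈ V, σ.symm v ∈ σ.source ∧ π (σ.symm v) ∈ (chartAt EB (π a)).source) ∧
      ContDiffOn ℂ ω (fun v => chartAt EB (π a) (π (σ.symm v))) V ∧
      HasFDerivAt (fun v => chartAt EB (π a) (π (σ.symm v)))
        (fderiv ℂ (fun v => chartAt EB (π a) (π (σ.symm v))) 0) 0 ∧
      (∀ g : G, (fderiv ℂ (fun v => chartAt EB (π a) (π (σ.symm v))) 0).comp (L g) =
        fderiv ℂ (fun v => chartAt EB (π a) (π (σ.symm v))) 0) ∧
      (∀ v : E, fderiv ℂ (fun v => chartAt EB (π a) (π (σ.symm v))) 0 v =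
        mfderiv 𝓘(ℂ, E) 𝓘(ℂ, EB) π a v) := by
  have hω : (ω : WithTop ℕ∞) ≠ 0 := by simp
  set φ : OpenPartialHomeomorph M E := chartAt E a with hφdef
  set ψ : OpenPartialHomeomorph B EB := chartAt EB (π a) with hψdef
  have hφmax : φ ∈ IsManifold.maximalAtlas 𝓘(ℂ, E) ω M := IsManifold.chart_mem_maximalAtlas a
  have hψmax : ψ ∈ IsManifold.maximalAtlas 𝓘(ℂ, EB) ω B :=
    IsManifold.chart_mem_maximalAtlas (π a)
  have haφ : a ∈ φ.source := mem_chart_source E a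
  have haψ : π a ∈ ψ.source := mem_chart_source EB (π a)
  -- `h = ψ ∘ π ∘ σ⁻¹` on `V = σ '' D`
  set D : Set M := σ.source ∩ π ⁻¹' ψ.source with hDdef
  have hDopen : IsOpen D := σ.open_source.inter (ψ.open_source.preimage hπ.continuous)
  have haD : a ∈ D := ⟨haσ, haψ⟩
  have hDsub : D ⊆ σ.source := inter_subset_left
  set V : Set E := σ '' D with hVdef
  have hVopen : IsOpen V := σ.isOpen_image_of_subset_source hDopen hDsub
  have h0V : (0 : E) ∈ V := ⟨a, haD, hσa⟩
  have hVnhds : V ∈ 𝓝 (0 : E) := hVopen.mem_nhds h0V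
  have hVtarget : V ⊆ σ.target := fun v ⟨x, hx, hxv⟩ => hxv ▸ σ.map_source (hDsub hx)
  have hVD : ∀ v ∈ V, σ.symm v ∈ D ∧ σ (σ.symm v) = v := by
    rintro v ⟨x, hx, rfl⟩
    rw [σ.left_inv (hDsub hx)]
    exact ⟨hx, rfl⟩
  set h : E → EB := fun v => ψ (π (σ.symm v)) with hhdef
  have hhV : ContDiffOn ℂ ω h V := by
    have hmaps : MapsTo π D ψ.source := fun x hx => hx.2
    have H := (contMDiffOn_iff_of_mem_maximalAtlas' hσmax hψmax hDsub hmaps).1 hπ.contMDiffOn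
    simp only [OpenPartialHomeomorph.extend_coe, OpenPartialHomeomorph.extend_coe_symm,
      modelWithCornersSelf_coe, modelWithCornersSelf_coe_symm, Function.id_comp,
      Function.comp_id] at H
    rw [hhdef, hVdef]
    simpa only [Function.comp_def] using H
  have hh0 : ContDiffAt ℂ ω h 0 := hhV.contDiffAt hVnhds
  set T : E →L[ℂ] EB := fderiv ℂ h 0 with hTdef
  have hhT : HasFDerivAt h T 0 := (hh0.differentiableAt hω).hasFDerivAt
  -- invariance `h ∘ L g = h` on `σ.target`, hence `T ∘ L g = T`
  have hhL : ∀ g : G, ∀ v ∈ σ.target, h (L g v) = h v := by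
    intro g v hv
    have hx : σ.symm v ∈ σ.source := σ.map_target hv
    have h1 : L g v = σ (ρ g (σ.symm v)) := by
      rw [hσlin g _ hx, σ.right_inv hv]
    show ψ (π (σ.symm (L g v))) = ψ (π (σ.symm v))
    rw [h1, σ.left_inv (hσstab g _ hx), hπρ]
  have hTL : ∀ g : G, T.comp (L g) = T := by
    intro g
    have heq : (h ∘ L g) =ᶠ[𝓝 0] h :=
      Filter.eventuallyEq_of_mem (σ.open_target.mem_nhds (hVtarget h0V)) fun v hv => hhL g v hv
    have h1 : HasFDerivAt (h ∘ L g) (T.comp (L g)) 0 := by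
      have hT' : HasFDerivAt h T (L g 0) := by rw [map_zero]; exact hhT
      exact hT'.comp 0 (L g).hasFDerivAt
    exact (heq.hasFDerivAt_iff.1 h1).unique hhT
  -- `T = dπ_a`: `h = (ψ ∘ π ∘ φ⁻¹) ∘ (φ ∘ σ⁻¹)` near `0`, the second factor tangent to `id`
  set P : E → EB := fun e => ψ (π (φ.symm e)) with hPdef
  have hmdπ : MDifferentiableAt 𝓘(ℂ, E) 𝓘(ℂ, EB) π a := hπ.mdifferentiableAt hω
  have hPmf : fderiv ℂ P (φ a) = mfderiv 𝓘(ℂ, E) 𝓘(ℂ, EB) π a := by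
    rw [hmdπ.mfderiv, writtenInExtChartAt, hPdef, hφdef, hψdef]
    simp only [extChartAt_coe, extChartAt_coe_symm, modelWithCornersSelf_coe,
      modelWithCornersSelf_coe_symm, Set.range_id, fderivWithin_univ, Function.comp_def, id_eq]
  set DP : Set M := φ.source ∩ π ⁻¹' ψ.source with hDPdef
  have hDPopen : IsOpen DP := φ.open_source.inter (ψ.open_source.preimage hπ.continuous)
  have hPV : ContDiffOn ℂ ω P (φ '' DP) := by
    have hmaps : MapsTo π DP ψ.source := fun x hx => hx.2
    have H := (contMDiffOn_iff_of_mem_maximalAtlas' hφmax hψmax inter_subset_left hmaps).1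
      hπ.contMDiffOn
    simp only [OpenPartialHomeomorph.extend_coe, OpenPartialHomeomorph.extend_coe_symm,
      modelWithCornersSelf_coe, modelWithCornersSelf_coe_symm, Function.id_comp,
      Function.comp_id] at H
    rw [hPdef]
    simpa only [Function.comp_def] using H
  have hPd : HasFDerivAt P (fderiv ℂ P (φ a)) (φ a) := by
    have hnhds : φ '' DP ∈ 𝓝 (φ a) :=
      (φ.isOpen_image_of_subset_source hDPopen inter_subset_left).mem_nhds ⟨a, ⟨haφ, haψ⟩, rfl⟩
    exact ((hPV.differentiableOn hω).differentiableAt hnhds).hasFDerivAt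
  set Q : E → E := fun v => φ (σ.symm v) with hQdef
  set DQ : Set M := σ.source ∩ φ.source with hDQdef
  have hQV : ContDiffOn ℂ ω Q (σ '' DQ) := by
    have hmaps : MapsTo (id : M → M) DQ φ.source := fun x hx => hx.2
    have H := (contMDiffOn_iff_of_mem_maximalAtlas' hσmax hφmax inter_subset_left hmaps).1
      contMDiff_id.contMDiffOn
    simp only [OpenPartialHomeomorph.extend_coe, OpenPartialHomeomorph.extend_coe_symm,
      modelWithCornersSelf_coe, modelWithCornersSelf_coe_symm, Function.id_comp,
      Function.comp_id] at H
    rw [hQdef]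
    simpa only [Function.comp_def] using H
  have hQ0 : Q 0 = φ a := by
    show φ (σ.symm 0) = φ a
    rw [← hσa, σ.left_inv haσ]
  have hQd : HasFDerivAt Q (fderiv ℂ Q 0) 0 := by
    have hnhds : σ '' DQ ∈ 𝓝 (0 : E) :=
      (σ.isOpen_image_of_subset_source (σ.open_source.inter φ.open_source)
        inter_subset_left).mem_nhds ⟨a, ⟨haσ, haφ⟩, hσa⟩
    exact ((hQV.differentiableOn hω).differentiableAt hnhds).hasFDerivAt
  have hmem0 : (0 : E) ∈ σ.target ∩ σ.symm ⁻¹' φ.source := by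
    refine ⟨hσa ▸ σ.map_source haσ, ?_⟩
    show σ.symm 0 ∈ φ.source
    rw [← hσa, σ.left_inv haσ]; exact haφ
  have hopen0 : IsOpen (σ.target ∩ σ.symm ⁻¹' φ.source) :=
    σ.isOpen_inter_preimage_symm φ.open_source
  have hQid : fderiv ℂ Q 0 = ContinuousLinearMap.id ℂ E := by
    have heq : ((σ ∘ φ.symm) ∘ Q) =ᶠ[𝓝 0] id := by
      refine Filter.eventuallyEq_of_mem (hopen0.mem_nhds hmem0) fun v hv => ?_
      show σ (φ.symm (φ (σ.symm v))) = v
      rw [φ.left_inv hv.2, σ.right_inv hv.1]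
    have h1 : HasFDerivAt ((σ ∘ φ.symm) ∘ Q)
        ((ContinuousLinearMap.id ℂ E).comp (fderiv ℂ Q 0)) 0 := by
      have hσtan' : HasFDerivAt (σ ∘ φ.symm) (ContinuousLinearMap.id ℂ E) (Q 0) := by
        rw [hQ0]; exact hσtan
      exact hσtan'.comp 0 hQd
    have h2 : HasFDerivAt (id : E → E) ((ContinuousLinearMap.id ℂ E).comp (fderiv ℂ Q 0)) 0 :=
      heq.hasFDerivAt_iff.1 h1
    have h3 := h2.unique (hasFDerivAt_id (𝕜 := ℂ) (0 : E))
    rw [ContinuousLinearMap.id_comp] at h3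
    exact h3
  have hTP : ∀ v : E, T v = mfderiv 𝓘(ℂ, E) 𝓘(ℂ, EB) π a v := by
    have heq : h =ᶠ[𝓝 0] (P ∘ Q) := by
      refine Filter.eventuallyEq_of_mem (hopen0.mem_nhds hmem0) fun v hv => ?_
      show ψ (π (σ.symm v)) = ψ (π (φ.symm (φ (σ.symm v))))
      rw [φ.left_inv hv.2]
    have h1 : HasFDerivAt (P ∘ Q) ((fderiv ℂ P (φ a)).comp (fderiv ℂ Q 0)) 0 := by
      have hPd' : HasFDerivAt P (fderiv ℂ P (φ a)) (Q 0) := by rw [hQ0]; exact hPd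
      exact hPd'.comp 0 hQd
    have h2 : T = (fderiv ℂ P (φ a)).comp (fderiv ℂ Q 0) :=
      hhT.unique (heq.symm.hasFDerivAt_iff.1 h1)
    intro v
    rw [h2, hQid, ContinuousLinearMap.comp_id, hPmf]
    exact rfl
  exact ⟨V, hVopen, h0V, hVtarget, fun v hv => ⟨hDsub (hVD v hv).1, (hVD v hv).1.2⟩, hhV, hhT,
    hTL, hTP⟩

end ChartData

end Literature.Geometry.Kaehler

end
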